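import Literature.NumberTheory.LFunctions.ExceptionalPrimesAssembly
import Literature.NumberTheory.LFunctions.ExceptionalPrimesMainTerm
import Literature.NumberTheory.LFunctions.SiegelZeroQualityBound
import Literature.NumberTheory.LFunctions.MertensElementary
import HarnessLib

/-!
# Exceptional primes are sparse: Heath-Brown's Lemma 3
# `∑_{p ≤ q^{500}, χ(p) = 1} (log p)/p ≪ (log q)/√(log η)` at a Siegel zero `β = 1 − 1/(η log q)`

Topic `Literature/NumberTheory/LFunctions`, namespace `Literature.NumberTheory.LFunctions.SiegelZero`.
Everything in this file is PROVED (theorems only; no definitions, no named facts). This is the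
ninth and final file of the elementary proof of Heath-Brown's lemma on exceptional primes announced
in the eight support files `ExceptionalPrimes{Abel,Hyperbola,PowerSums,Combinatorics,MainTerm,
Windows,Parameters,Assembly}.lean`; it only assembles their theorems.

**The statement.** D. R. Heath-Brown, *Prime twins and Siegel zeros*, Proc. London Math. Soc. (3)
47 (1983), Lemma 3, as quoted by Tao–Teräväinen [TaoTeravainen2021, §3.3 (3.20) and footnote 5]
("in [11, Lemma 3] it was shown that `∑_{p* ≤ q_χ^{500}} (log p*)/p* ≪ (log q_χ)/√(log η)`",
the sum over the primes with `χ(p) = 1`) and by Bondarenko–Heap [BondarenkoHeap2026, Proposition 3,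
(10)] ("Let `β = 1 − (𝓔 log q)^{−1}` be a real zero of `L(s, χ)`, with `𝓔 ⩾ 3`. Then
`∑_{p ⩽ q^{500}, χ(p)=1} (log p)/p ≪ (log q)/√(log 𝓔)` where the implied constant is absolute"):
for `χ` a primitive quadratic character modulo `q` and `η ≥ 3` with `L(1 − 1/(η log q), χ) = 0`.

* `sum_one_add_re_mul_log_div_le_of_large` — the main regime with an explicit constant:
  for `log q ≥ 6400`, `η ≥ 10⁴` and `log η ≤ (log q)/5`,
  `∑_{p ≤ q^{500}} (1 + χ(p)) (log p)/p ≤ 520000 · (log q)/√(log η)`.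
  Proof = Tao–Teräväinen's remark after Proposition 3.5 ("taking a suitable linear combination of
  (3.22) and (3.23) for `m ≤ √log η`, and using Mertens' theorem … we leave the details to the
  interested reader"), whose details ARE the support files: `SiegelZero.assembly`
  (`ExceptionalPrimesAssembly.lean`) applied to the weight `g(n) = (1∗χ)(n) n^{−β}` and
  `h(p) = (1 + χ(p)) (log p)/p`, with the main-term ratios on `(q^4, q^{13}]` and `(q^4, q^{504}]`
  supplied by `sum_Ioc_zetaMul_rpow_le_mul_base` (`ExceptionalPrimesMainTerm.lean`); the side
  conditions `q^{4(1−β)} = e^{4/η} ≤ 1.01`, `η log q ≤ q^{3/10}`, `16154 η ≤ √q` are arithmetic.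
* `HeathBrown1983_lemma3_one_add` — the absolute-constant form over all primes `p ≤ q^{500}` with
  the weight `1 + χ(p)` (this also covers the primes with `χ(p) = 0`, cf. footnote 5 of
  [TaoTeravainen2021]): there is `C > 0` with `∑_{p ≤ q^{500}} (1 + χ(p)) (log p)/p ≤ C (log q)/√(log η)`
  for every primitive quadratic `χ` mod `q`, every `η ≥ 3` with `L(1 − 1/(η log q), χ) = 0`. The
  complementary regimes are trivial: for `η < η₁` or `log q < 6400` the quality is bounded
  (`SiegelZeroQuality.eta_le_mul_rpow`: `η ≤ C₁ q`, Siegel's theorem — the constant is therefore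
  INEFFECTIVE, as is Heath-Brown's) and Mertens' `∑_{p ≤ n} (log p)/p ≤ log n + log 4`
  (`MertensBound.sum_log_div_prime_le`) suffices; `log η ≤ (log q)/5` for `η ≥ η₀` is
  `SiegelZeroQuality.exists_log_eta_le_mul_log`.
* `HeathBrown1983_lemma3` — **Heath-Brown's Lemma 3 as printed** (the sum over `χ(p) = 1`).

RH-free; no `ζ`-zeros. Nothing here bears on the truth of RH or on the existence of Siegel zeros:
these are statements about primes GIVEN a real zero of quality `η`.

## References

* [Heathbrown1983] D. R. Heath-Brown, *Prime twins and Siegel zeros*, Proc. London Math. Soc. (3)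
  47 (1983), 193–224, Lemma 3 (cite-only here; statement taken from the two secondary sources).
* [TaoTeravainen2021] T. Tao, J. Teräväinen, *The Hardy–Littlewood–Chowla conjecture in the
  presence of a Siegel zero*, J. London Math. Soc. (2) 106 (2022), arXiv:2109.06291, §3.3:
  (3.20), footnote 5, Proposition 3.5 and the remark following it (p. 15–16 of the arXiv version).
* [BondarenkoHeap2026] A. Bondarenko, W. Heap, arXiv:2608.07399v1, §3, Proposition 3, eq. (10).
* [HardyWright2008] G. H. Hardy, E. M. Wright, *An Introduction to the Theory of Numbers*, Thm 425.
-/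

noncomputable section

open Finset ArithmeticFunction

namespace Literature.NumberTheory.LFunctions.SiegelZero

/-! ### Arithmetic side conditions -/

/-- `e^{4/η} ≤ 1.01` for `η ≥ 10⁴`. [folklore] -/
private theorem exp_four_div_le {η : ℝ} (hη : 10000 ≤ η) : Real.exp (4 / η) ≤ 101 / 100 := by
  have hη0 : 0 < η := by linarith
  have h0 : 0 ≤ 4 / η := by positivity
  have h1 : 4 / η ≤ 4 / 10000 := div_le_div_of_nonneg_left (by norm_num) (by norm_num) hη
  have hx : |4 / η| ≤ 1 := by rw [abs_of_nonneg h0]; linarith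
  have h := Real.abs_exp_sub_one_le hx
  have h3 := (abs_le.mp h).2
  rw [abs_of_nonneg h0] at h3
  linarith

/-- `9 ≤ log η` for `η ≥ 10⁴` (`e^9 < 8104`). [folklore] -/
private theorem nine_le_log {η : ℝ} (hη : 10000 ≤ η) : 9 ≤ Real.log η := by
  have hη0 : 0 < η := by linarith
  rw [Real.le_log_iff_exp_le hη0]
  have h1 : Real.exp 9 = Real.exp 1 ^ 9 := by rw [Real.exp_one_pow]; norm_num
  rw [h1]
  have he := Real.exp_one_lt_d9
  have he0 := Real.exp_pos 1
  have h2 : Real.exp 1 ^ 9 ≤ (2.7182818286 : ℝ) ^ 9 := by gcongr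
  have h3 : (2.7182818286 : ℝ) ^ 9 ≤ 10000 := by norm_num
  linarith

/-- `log x ≤ x/10` for `x ≥ 6400` (indeed `log x ≤ x/e · …`; we use `log x ≤ 2√x`). [folklore] -/
private theorem log_le_div_ten {x : ℝ} (hx : 6400 ≤ x) : Real.log x ≤ x / 10 := by
  have hx0 : 0 < x := by linarith
  -- `log x = 2 log √x ≤ 2 (√x − 1) < 2 √x`, and `2√x ≤ x/10` iff `√x ≥ 20` iff `x ≥ 400`.
  have hs0 : 0 < Real.sqrt x := Real.sqrt_pos.mpr hx0
  have hsq : Real.sqrt x * Real.sqrt x = x := Real.mul_self_sqrt hx0.le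
  have h1 : Real.log x = 2 * Real.log (Real.sqrt x) := by
    conv_lhs => rw [← hsq]
    rw [Real.log_mul hs0.ne' hs0.ne']; ring
  have h2 : Real.log (Real.sqrt x) ≤ Real.sqrt x - 1 := Real.log_le_sub_one_of_pos hs0
  have h80 : 80 ≤ Real.sqrt x := by
    rw [show (80 : ℝ) = Real.sqrt (80 ^ 2) by rw [Real.sqrt_sq (by norm_num)]]
    exact Real.sqrt_le_sqrt (by linarith)
  nlinarith

/-! ### The main regime -/

/-- **Heath-Brown's Lemma 3, main regime, explicit constant.** Let `χ` be a primitive quadratic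
character mod `q` with `log q ≥ 6400`, and let `η ≥ 10⁴` with `log η ≤ (log q)/5` and
`L(1 − 1/(η log q), χ) = 0`. Then `∑_{p ≤ q^{500}} (1 + χ(p)) (log p)/p ≤ 520000 (log q)/√(log η)`.
This is `SiegelZero.assembly` for `g(n) = (1∗χ)(n) n^{−β}`, `β = 1 − 1/(η log q)`, `μ = √(log η)`,
with `ρ₁ = 18.18/η + 2E₀`, `ρ₂ = 1010/η + 2E₀`, `E₀ = 16154 q^{−1/2} ≤ 1/η`
(`sum_Ioc_zetaMul_rpow_le_mul_base` at `k = 13` and `k = 504`).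
[cite: TaoTeravainen2021, §3.3 (3.20) and the remark after Proposition 3.5] -/
theorem sum_one_add_re_mul_log_div_le_of_large {q : ℕ} [NeZero q] (χ : DirichletCharacter ℂ q)
    (hprim : χ.IsPrimitive) (hquad : χ.IsQuadratic) {η : ℝ} (hη : 10000 ≤ η)
    (hLq : 6400 ≤ Real.log q) (hηL : Real.log η ≤ 1 / 5 * Real.log q)
    (h0 : χ.LFunction ((1 - 1 / (η * Real.log q) : ℝ) : ℂ) = 0) :
    ∑ p ∈ Nat.primesLE (q ^ 500), (1 + (χ (p : ZMod q)).re) * Real.log p / p ≤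
      520000 * Real.log q / Real.sqrt (Real.log η) := by
  classical
  -- sizes of `q`
  have hq3 : 3 ≤ q := by
    by_contra hlt
    push Not at hlt
    have hq2 : (q : ℝ) ≤ 2 := by exact_mod_cast (by omega : q ≤ 2)
    have hq0 : (0 : ℝ) < q := by exact_mod_cast Nat.pos_of_ne_zero (NeZero.ne q)
    have : Real.log q ≤ Real.log 2 := Real.log_le_log hq0 hq2
    have h2 : Real.log 2 < 1 := by
      have := Real.log_two_lt_d9; linarith
    linarith
  have hq0 : (0 : ℝ) < q := by exact_mod_cast (show 0 < q by omega)
  have hq1 : (1 : ℝ) < q := by exact_mod_cast (show 1 < q by omega)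
  set L : ℝ := Real.log q with hLdef
  have hL0 : 0 < L := by linarith
  have hsq : χ ^ 2 = 1 := MulChar.isQuadratic_iff_sq_eq_one.mp hquad
  have hne : χ ≠ 1 := SiegelZeroQuality.ne_one_of_isPrimitive hprim (by omega)
  have hη0 : 0 < η := by linarith
  have hη1000 : 1000 ≤ η := by linarith
  -- the zero and the weight
  set β : ℝ := 1 - 1 / (η * L) with hβdef
  have hηL0 : 0 < η * L := mul_pos hη0 hL0
  have hβ1 : β ≤ 1 := by
    have : 0 ≤ 1 / (η * L) := by positivity
    linarith
  have h1β : 1 - β = 1 / (η * L) := by rw [hβdef]; ring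
  let g : ArithmeticFunction ℝ :=
    ⟨fun n => (χ.zetaMul n).re * (n : ℝ) ^ (-β), by simp⟩
  have hg : ∀ n, g n = (χ.zetaMul n).re * (n : ℝ) ^ (-β) := fun n => rfl
  have hgm : g.IsMultiplicative := weight_isMultiplicative χ hsq hg
  have hg0 : ∀ n, 0 ≤ g n := weight_nonneg χ hsq hg
  have hgpk : ∀ p k : ℕ, p.Prime → 1 ≤ k → g (p ^ k) ≤ (k + 1 : ℝ) * ((p : ℝ) ^ (-β)) ^ k :=
    fun p k hp _ => weight_prime_pow_le χ hsq hg p k hp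
  -- the prime weight `h(p) = (1 + χ(p)) log p / p`
  set h : ℕ → ℝ := fun p => (1 + (χ (p : ZMod q)).re) * Real.log p / p with hhdef
  have hh2 : ∀ p, p.Prime → h p ≤ 2 * Real.log p / p := fun p hp => (prime_term_bounds χ hp).2
  have hhg : ∀ p, p.Prime → h p ≤ Real.log p * g p := fun p hp => prime_weight_le χ hsq hβ1 hg hp
  -- `q^{4(1-β)} = e^{4/η} ≤ 1.01`
  have hq4β : (q : ℝ) ^ (4 * (1 - β)) ≤ 101 / 100 := by
    have : (q : ℝ) ^ (4 * (1 - β)) = Real.exp (4 / η) := by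
      rw [Real.rpow_def_of_pos hq0, h1β, ← hLdef]
      congr 1
      field_simp
    rw [this]
    exact exp_four_div_le hη
  -- `μ = √(log η)`
  set μ : ℝ := Real.sqrt (Real.log η) with hμdef
  have hlogη9 : 9 ≤ Real.log η := nine_le_log hη
  have hlogη0 : 0 ≤ Real.log η := by linarith
  have hμ2 : μ ^ 2 = Real.log η := Real.sq_sqrt hlogη0
  have hμ3 : 3 ≤ μ := by
    rw [hμdef, show (3 : ℝ) = Real.sqrt (3 ^ 2) by rw [Real.sqrt_sq (by norm_num)]]
    exact Real.sqrt_le_sqrt (by linarith)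
  have hμ0 : 0 < μ := by linarith
  have hμL : μ ^ 2 ≤ 3 / 10 * L := by rw [hμ2]; linarith
  have hμη : μ ≤ η := by
    -- `μ ≤ μ² = log η ≤ η - 1 ≤ η`
    have h1 : μ ≤ μ ^ 2 := by nlinarith
    have h2 : Real.log η ≤ η - 1 := Real.log_le_sub_one_of_pos hη0
    rw [hμ2] at h1
    linarith
  have hη41 : 41 ≤ η := by linarith
  -- `η ≤ q^{1/5}`, `log q ≤ q^{1/10}`, hence `η log q ≤ q^{3/10}` and `16154 η ≤ √q`
  have hηq5 : η ≤ (q : ℝ) ^ (1 / 5 : ℝ) := by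
    rw [← Real.log_le_log_iff hη0 (Real.rpow_pos_of_pos hq0 _), Real.log_rpow hq0]
    linarith
  have hLq10 : L ≤ (q : ℝ) ^ (1 / 10 : ℝ) := by
    -- `log L ≤ L/10` since `L ≥ 6400`
    rw [← Real.log_le_log_iff hL0 (Real.rpow_pos_of_pos hq0 _), Real.log_rpow hq0, ← hLdef]
    have := log_le_div_ten hLq
    linarith
  have hηq : η * Real.log q ≤ (q : ℝ) ^ (3 / 10 : ℝ) := by
    rw [← hLdef]
    calc η * L ≤ (q : ℝ) ^ (1 / 5 : ℝ) * (q : ℝ) ^ (1 / 10 : ℝ) :=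
          mul_le_mul hηq5 hLq10 hL0.le (Real.rpow_nonneg hq0.le _)
      _ = (q : ℝ) ^ (3 / 10 : ℝ) := by
          rw [← Real.rpow_add hq0]; norm_num
  set E₀ : ℝ := 16154 * (q : ℝ) ^ (-(1 / 2 : ℝ)) with hE₀def
  have hE₀0 : 0 ≤ E₀ := by positivity
  have hE₀η : E₀ * η ≤ 1 := by
    -- `16154 ≤ q^{3/10}` (as `log 16154 ≤ 10 ≤ 3L/10`), `η ≤ q^{1/5}`, so `16154 η ≤ q^{1/2}`
    have h16154 : (16154 : ℝ) ≤ (q : ℝ) ^ (3 / 10 : ℝ) := by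
      rw [← Real.log_le_log_iff (by norm_num) (Real.rpow_pos_of_pos hq0 _), Real.log_rpow hq0,
        ← hLdef]
      have h1 : Real.log (16154 : ℝ) ≤ 10 := by
        rw [Real.log_le_iff_le_exp (by norm_num)]
        have h2 : Real.exp 10 = Real.exp 1 ^ 10 := by rw [Real.exp_one_pow]; norm_num
        rw [h2]
        have he := Real.exp_one_gt_d9
        have h3 : (2.7182818283 : ℝ) ^ 10 ≤ Real.exp 1 ^ 10 := by gcongr
        have h4 : (16154 : ℝ) ≤ (2.7182818283 : ℝ) ^ 10 := by norm_num
        linarith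
      linarith
    have hprod : 16154 * η ≤ (q : ℝ) ^ (3 / 10 : ℝ) * (q : ℝ) ^ (1 / 5 : ℝ) :=
      mul_le_mul h16154 hηq5 hη0.le (Real.rpow_nonneg hq0.le _)
    rw [← Real.rpow_add hq0, show (3 / 10 : ℝ) + 1 / 5 = 1 / 2 by norm_num] at hprod
    have hhalf : (q : ℝ) ^ (1 / 2 : ℝ) * (q : ℝ) ^ (-(1 / 2 : ℝ)) = 1 := by
      rw [← Real.rpow_add hq0]; norm_num
    calc E₀ * η = (16154 * η) * (q : ℝ) ^ (-(1 / 2 : ℝ)) := by rw [hE₀def]; ring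
      _ ≤ ((q : ℝ) ^ (1 / 2 : ℝ)) * (q : ℝ) ^ (-(1 / 2 : ℝ)) :=
          mul_le_mul_of_nonneg_right hprod (Real.rpow_nonneg hq0.le _)
      _ = 1 := hhalf
  have hE₀le : E₀ ≤ 1 / η := by
    rw [le_div_iff₀ hη0]; exact hE₀η
  have hE : 16154 * (q : ℝ) ^ (-(1 / 2 : ℝ)) ≤ 1 / 100 := by
    rw [← hE₀def]
    exact hE₀le.trans (div_le_div_of_nonneg_left (by norm_num) (by norm_num) (by linarith))
  -- the main-term ratios
  set G4 : ℝ := ∑ n ∈ Icc 1 (q ^ 4), g n with hG4def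
  have hbase1 : 1 ≤ G4 := by
    have := one_le_sum_zetaMul_rpow χ hsq β (X := q ^ 4) (Nat.one_le_pow _ _ (by omega))
    simpa [hG4def, hg] using this
  have hbase : 0 < G4 := by linarith
  set ρ₁ : ℝ := 202 / 100 * ((13 : ℕ) - 4 : ℝ) / η + 2 * E₀ with hρ₁def
  set ρ₂ : ℝ := 202 / 100 * ((4 + 500 : ℕ) - 4 : ℝ) / η + 2 * E₀ with hρ₂def
  have hρ₁0 : 0 ≤ ρ₁ := by rw [hρ₁def]; positivity
  have hρ₁ : 2 * ρ₁ ≤ 41 / η := by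
    rw [hρ₁def]
    have : 2 * (202 / 100 * ((13 : ℕ) - 4 : ℝ) / η + 2 * E₀) = 3636 / 100 / η + 4 * E₀ := by
      push_cast; ring
    rw [this]
    have h4 : 4 * E₀ ≤ 4 / η := by
      have := hE₀le; rw [show 4 / η = 4 * (1 / η) by ring]; linarith
    rw [show (41 : ℝ) / η = 3636 / 100 / η + 464 / 100 / η by ring]
    have h5 : 4 / η ≤ 464 / 100 / η := div_le_div_of_nonneg_right (by norm_num) hη0.le
    linarith
  have hρ₂ : ρ₂ ≤ 1012 / η := by
    rw [hρ₂def]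
    have : 202 / 100 * ((4 + 500 : ℕ) - 4 : ℝ) / η + 2 * E₀ = 1010 / η + 2 * E₀ := by
      push_cast; ring
    rw [this, show (1012 : ℝ) / η = 1010 / η + 2 * (1 / η) by ring]
    linarith
  have hmain := fun (k : ℕ) (hk4 : 4 ≤ k) (hk : k ≤ 504) =>
    sum_Ioc_zetaMul_rpow_le_mul_base χ hne hsq hq3 hη1000 hηq hE h0 hk4 hk
  have h13 : ∑ N ∈ Ioc (q ^ 4) (q ^ 13), g N ≤ ρ₁ * G4 := hmain 13 (by norm_num) (by norm_num)
  -- (`4 + 500` rather than the literal `504`: keeps the kernel's exponent guard quiet, as in `assembly`)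
  have h504 : ∑ N ∈ Ioc (q ^ 4) (q ^ (4 + 500)), g N ≤ ρ₂ * G4 :=
    hmain (4 + 500) (by norm_num) (by norm_num)
  -- assemble
  have hA := assembly hgm hg0 hh2 hhg hq3 hβ1 hgpk hq4β hLdef hLq hμ2 hμ3 hμL hμη hη41 hρ₁0 hρ₁
    hρ₂ hbase h13 h504
  -- `520000 · (L/μ) = 520000 L / √(log η)`
  calc ∑ p ∈ Nat.primesLE (q ^ 500), (1 + (χ (p : ZMod q)).re) * Real.log p / p
      = ∑ p ∈ Nat.primesLE (q ^ 500), h p := rfl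
    _ ≤ 520000 * (L / μ) := hA
    _ = 520000 * Real.log q / Real.sqrt (Real.log η) := by rw [hLdef, hμdef]; ring

/-! ### The trivial regimes and the absolute-constant form -/

/-- Mertens: `∑_{p ≤ q^{500}} (1 + χ(p)) (log p)/p ≤ 1004 log q` for `q ≥ 2`. [folklore] -/
private theorem sum_one_add_re_mul_log_div_le_trivial {q : ℕ} [NeZero q] (χ : DirichletCharacter ℂ q)
    (hq : 2 ≤ q) :
    ∑ p ∈ Nat.primesLE (q ^ 500), (1 + (χ (p : ZMod q)).re) * Real.log p / p ≤
      1004 * Real.log q := by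
  have hq0 : (0 : ℝ) < q := by exact_mod_cast (show 0 < q by omega)
  have hq2 : (2 : ℝ) ≤ q := by exact_mod_cast hq
  have hlog2 : Real.log 2 ≤ Real.log q := Real.log_le_log two_pos hq2
  have h1 : ∑ p ∈ Nat.primesLE (q ^ 500), (1 + (χ (p : ZMod q)).re) * Real.log p / p ≤
      ∑ p ∈ Nat.primesLE (q ^ 500), 2 * Real.log p / p := by
    refine Finset.sum_le_sum fun p hp => ?_
    exact (prime_term_bounds χ (Nat.mem_primesLE.mp hp).2).2
  have h2 : ∑ p ∈ Nat.primesLE (q ^ 500), 2 * Real.log p / p =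
      2 * ∑ p ∈ Nat.primesLE (q ^ 500), Real.log p / p := by
    rw [Finset.mul_sum]
    refine Finset.sum_congr rfl fun p _ => by ring
  have h3 := MertensBound.sum_log_div_prime_le (q ^ 500)
  have h4 : Real.log ((q ^ 500 : ℕ) : ℝ) = 500 * Real.log q := by
    push_cast
    rw [Real.log_pow]; norm_num
  have h5 : Real.log 4 = 2 * Real.log 2 := by
    rw [show (4 : ℝ) = 2 ^ 2 by norm_num, Real.log_pow]; norm_num
  rw [h4, h5] at h3
  calc ∑ p ∈ Nat.primesLE (q ^ 500), (1 + (χ (p : ZMod q)).re) * Real.log p / p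
      ≤ 2 * ∑ p ∈ Nat.primesLE (q ^ 500), Real.log p / p := h1.trans h2.le
    _ ≤ 2 * (500 * Real.log q + 2 * Real.log 2) := by gcongr
    _ ≤ 1004 * Real.log q := by nlinarith

/-- **Heath-Brown's Lemma 3 with the weight `1 + χ(p)`** (absolute, ineffective constant): there is
`C > 0` such that for every primitive quadratic character `χ` mod `q` and every `η ≥ 3` with
`L(1 − 1/(η log q), χ) = 0`, `∑_{p ≤ q^{500}} (1 + χ(p)) (log p)/p ≤ C (log q)/√(log η)`.
[cite: TaoTeravainen2021, §3.3 (3.20) and footnote 5] -/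
theorem HeathBrown1983_lemma3_one_add :
    ∃ C : ℝ, 0 < C ∧ ∀ (q : ℕ) [NeZero q] (χ : DirichletCharacter ℂ q), χ.IsPrimitive →
      χ.IsQuadratic → ∀ η : ℝ, 3 ≤ η → χ.LFunction ((1 - 1 / (η * Real.log q) : ℝ) : ℂ) = 0 →
        ∑ p ∈ Nat.primesLE (q ^ 500), (1 + (χ (p : ZMod q)).re) * Real.log p / p ≤
          C * Real.log q / Real.sqrt (Real.log η) := by
  classical
  -- thresholds
  obtain ⟨η₀, hη₀0, Hlog⟩ := SiegelZeroQuality.exists_log_eta_le_mul_log (show (0 : ℝ) < 1 / 5 by norm_num)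
  obtain ⟨C₁, hC₁, Hη⟩ := SiegelZeroQuality.eta_le_mul_rpow one_pos
  set η₁ : ℝ := max η₀ 10000 with hη₁def
  have hη₁0 : 1 < η₁ := lt_of_lt_of_le (by norm_num) (le_max_right _ _)
  -- in the trivial regimes `log η ≤ S`, `S = log η₁ + |log C₁| + 6400 + 1`
  set S : ℝ := Real.log η₁ + |Real.log C₁| + 6400 + 1 with hSdef
  have hlogη₁ : 0 < Real.log η₁ := Real.log_pos hη₁0
  have hS1 : 1 ≤ S := by have := abs_nonneg (Real.log C₁); linarith
  have hS0 : 0 < S := by linarith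
  set C : ℝ := 520000 + 1004 * Real.sqrt S with hCdef
  have hC0 : 0 < C := by positivity
  refine ⟨C, hC0, ?_⟩
  intro q _ χ hprim hquad η hη3 h0
  have hη0 : 0 < η := by linarith
  have hlogη0 : 0 < Real.log η := Real.log_pos (by linarith)
  have hsqrt0 : 0 < Real.sqrt (Real.log η) := Real.sqrt_pos.mpr hlogη0
  have hqpos : 0 < q := Nat.pos_of_ne_zero (NeZero.ne q)
  -- `q = 1`: no primes `≤ 1`, both sides vanish / are `≥ 0`
  rcases Nat.lt_or_ge q 2 with hq1 | hq2
  · have hq1' : q = 1 := by omega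
    subst hq1'
    have hempty : Nat.primesLE (1 ^ 500) = ∅ := by rw [Nat.one_pow]; decide
    rw [hempty, Finset.sum_empty]
    simp
  have hq0 : (0 : ℝ) < q := by exact_mod_cast hqpos
  have hq2r : (2 : ℝ) ≤ q := by exact_mod_cast hq2
  have hlogq : 0 < Real.log q := Real.log_pos (by linarith)
  have htriv := sum_one_add_re_mul_log_div_le_trivial χ hq2
  -- the trivial bound suffices once `log η ≤ S`
  have key : Real.log η ≤ S →
      ∑ p ∈ Nat.primesLE (q ^ 500), (1 + (χ (p : ZMod q)).re) * Real.log p / p ≤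
        C * Real.log q / Real.sqrt (Real.log η) := by
    intro hle
    have hs : Real.sqrt (Real.log η) ≤ Real.sqrt S := Real.sqrt_le_sqrt hle
    rw [le_div_iff₀ hsqrt0]
    calc (∑ p ∈ Nat.primesLE (q ^ 500), (1 + (χ (p : ZMod q)).re) * Real.log p / p) *
          Real.sqrt (Real.log η)
        ≤ (1004 * Real.log q) * Real.sqrt S :=
          mul_le_mul htriv hs hsqrt0.le (by positivity)
      _ = (1004 * Real.sqrt S) * Real.log q := by ring
      _ ≤ C * Real.log q := by
          refine mul_le_mul_of_nonneg_right ?_ hlogq.le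
          rw [hCdef]; linarith
  by_cases hηsmall : η < η₁
  · -- regime (ii): bounded quality
    refine key ?_
    have : Real.log η ≤ Real.log η₁ := Real.log_le_log hη0 hηsmall.le
    have := abs_nonneg (Real.log C₁)
    linarith
  push Not at hηsmall
  have hη₀le : η₀ ≤ η := le_trans (le_max_left _ _) hηsmall
  have hη4 : 10000 ≤ η := le_trans (le_max_right _ _) hηsmall
  by_cases hLq : Real.log q < 6400
  · -- regime (iii): bounded level, `η ≤ C₁ q`
    refine key ?_
    have h1 := Hη q χ hprim hquad hq2 η hη0 h0
    rw [Real.rpow_one] at h1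
    have h2 : Real.log η ≤ Real.log C₁ + Real.log q := by
      rw [← Real.log_mul hC₁.ne' hq0.ne']
      exact Real.log_le_log hη0 h1
    have h3 := le_abs_self (Real.log C₁)
    linarith
  push Not at hLq
  -- regime (i)
  have hηL := Hlog q χ hprim hquad hq2 η hη₀le h0
  have hM := sum_one_add_re_mul_log_div_le_of_large χ hprim hquad hη4 hLq hηL h0
  refine hM.trans ?_
  rw [div_le_div_iff_of_pos_right hsqrt0]
  refine mul_le_mul_of_nonneg_right ?_ hlogq.le
  rw [hCdef]
  have : 0 ≤ 1004 * Real.sqrt S := by positivity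
  linarith

/-- **Heath-Brown 1983, Lemma 3** (as quoted in [TaoTeravainen2021, (3.20)] and
[BondarenkoHeap2026, Proposition 3 (10)]): there is an absolute `C > 0` such that for every
primitive quadratic character `χ` modulo `q` and every real `η ≥ 3` for which
`β = 1 − 1/(η log q)` is a zero of `L(s, χ)`,
`∑_{p ≤ q^{500}, χ(p) = 1} (log p)/p ≤ C (log q)/√(log η)`.
(The constant is ineffective: the trivial regimes use Siegel's theorem through
`SiegelZeroQuality.eta_le_mul_rpow`.) [cite: Heathbrown1983, Lemma 3] -/
theorem HeathBrown1983_lemma3 :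
    ∃ C : ℝ, 0 < C ∧ ∀ (q : ℕ) [NeZero q] (χ : DirichletCharacter ℂ q), χ.IsPrimitive →
      χ.IsQuadratic → ∀ η : ℝ, 3 ≤ η → χ.LFunction ((1 - 1 / (η * Real.log q) : ℝ) : ℂ) = 0 →
        ∑ p ∈ (Nat.primesLE (q ^ 500)).filter (fun p : ℕ => χ (p : ZMod q) = 1), Real.log p / p ≤
          C * Real.log q / Real.sqrt (Real.log η) := by
  classical
  obtain ⟨C, hC, H⟩ := HeathBrown1983_lemma3_one_add
  refine ⟨C, hC, fun q _ χ hprim hquad η hη h0 => ?_⟩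
  have hmain := H q χ hprim hquad η hη h0
  refine le_trans ?_ hmain
  -- on `χ(p) = 1` the weight is `2 log p / p ≥ log p / p`; the other terms are `≥ 0`
  rw [← Finset.sum_filter_add_sum_filter_not (Nat.primesLE (q ^ 500)) (fun p : ℕ => χ (p : ZMod q) = 1)]
  have hnn : 0 ≤ ∑ p ∈ (Nat.primesLE (q ^ 500)).filter (fun p : ℕ => ¬ χ (p : ZMod q) = 1),
      (1 + (χ (p : ZMod q)).re) * Real.log p / p :=
    Finset.sum_nonneg fun p hp => (prime_term_bounds χ (Nat.mem_primesLE.mp (mem_filter.mp hp).1).2).1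
  have hle : ∑ p ∈ (Nat.primesLE (q ^ 500)).filter (fun p : ℕ => χ (p : ZMod q) = 1), Real.log p / p ≤
      ∑ p ∈ (Nat.primesLE (q ^ 500)).filter (fun p : ℕ => χ (p : ZMod q) = 1),
        (1 + (χ (p : ZMod q)).re) * Real.log p / p := by
    refine Finset.sum_le_sum fun p hp => ?_
    have h1 : χ (p : ZMod q) = 1 := (mem_filter.mp hp).2
    have hp1 : (1 : ℝ) ≤ p := by exact_mod_cast (Nat.mem_primesLE.mp (mem_filter.mp hp).1).2.one_lt.le
    rw [h1, Complex.one_re]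
    have : 0 ≤ Real.log p / p := div_nonneg (Real.log_nonneg hp1) (by linarith)
    calc Real.log p / p ≤ 2 * (Real.log p / p) := by linarith
      _ = (1 + 1) * Real.log p / p := by ring
  linarith

end Literature.NumberTheory.LFunctions.SiegelZero

end
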